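import Mathlib
import Summits.Ventures.PercRepro2.SwOutShadowMultiRootFibre

/-!
# THE FIBRATION BY THE ESCAPING SET: the multi-junction class from the decorated cubes (blind
cell PercRepro2, night-4 g35, 2026-08-29; proofs/NIGHT4-G35.md §4)

g34's exemption induction fibred the side of a class with the junctions `J` by the set of the
junctions in the RED cluster of `l` and needed (★) — no junction escapes in blue.  Here the side
is fibred by the ESCAPING SET `escSetE` — the junctions whose hull leaves the region, in EITHER
colour: the fibre of `T ⊆ J` is the part with the roots `h` and `J ∖ T` non-escaping and the
junctions of `T` escaping (`mem_fibreE_iff`), and the fibre theorem `rigidOK_g_of_decoFibre` on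
every fibre gives the rigid counting inequality on the whole side —
**`rigidOK_g_of_junctions_deco`** — with no hypothesis on the colours of the escapes, under the
canonical conditions of the decorated cubes at every side point of every fibre.
-/

namespace Summit.Ventures.PercRepro2

namespace LocRows

open Hull

universe u v

variable {V : Type u} {E : Type v} [Fintype E] [DecidableEq E]

open scoped Classical

variable {ends : E → Sym2 V} {U : Set V} {ξ : Config E} {l h : V}
  {𝓤 𝓓 𝓓'' : Set (Set V)} {X : Set V} {𝓤' : Set (Set V)} {F : V → Prop}

/-- The escaping set of a side point: the junctions whose hull leaves the region. -/
noncomputable def escSetE (ends : E → Sym2 V) (J : Finset V) (U : Set V) (ζ : Config E) :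
    Finset V :=
  J.filter fun u => ¬ hull ends ζ u ⊆ U

/-- **The fibre of the escaping set `T`** is the part with the roots `h` and `J ∖ T` non-escaping
and the junctions of `T` escaping. -/
lemma mem_fibreE_iff {J : Finset V} {T : Finset V} (hT : T ⊆ J) {ζ : Config E}
    (hζ : ζ ∈ gOutSide ends l h 𝓤 𝓓 𝓓'' X 𝓤' U ξ) :
    escSetE ends J U ζ = T ↔
      (∀ r ∈ insert h (↑(J \ T) : Set V), hull ends ζ r ⊆ U) ∧
        (∀ u ∈ (↑T : Set V), ¬ hull ends ζ u ⊆ U) := by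
  constructor
  · intro hesc
    refine ⟨fun r hr => ?_, fun u hu => ?_⟩
    · rcases hr with rfl | hr
      · exact (mem_outClass.1 (mem_gOutSide.1 hζ).2).2
      · rw [Finset.mem_coe, Finset.mem_sdiff] at hr
        by_contra hne
        exact hr.2 (hesc ▸ Finset.mem_filter.2 ⟨hr.1, hne⟩)
    · rw [Finset.mem_coe] at hu
      rw [← hesc] at hu
      exact (Finset.mem_filter.1 hu).2
  · rintro ⟨hne, hT'⟩
    ext u
    simp only [escSetE, Finset.mem_filter]
    constructor
    · rintro ⟨huJ, hul⟩
      by_contra huT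
      have hu : u ∈ insert h (↑(J \ T) : Set V) := Or.inr (by
        rw [Finset.mem_coe, Finset.mem_sdiff]; exact ⟨huJ, huT⟩)
      exact hul (hne u hu)
    · intro huT
      exact ⟨hT huT, hT' u (Finset.mem_coe.2 huT)⟩

/-- **THE MULTI-JUNCTION CLASS FROM THE DECORATED CUBES**: the rigid counting inequality on the
general doubly typed side of every class of a region with the junctions `J` (no loop at `h` or a
junction, every other vertex of `U` exempt, in `X`, with an outside edge, or isolated; `X` avoids
`{h} ∪ J`), the side fibred by the escaping set in either colour, under the canonical conditions
of the decorated cubes on every fibre. -/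
theorem rigidOK_g_of_junctions_deco (h𝓤 : IsUpperSet 𝓤) (h𝓓 : IsLowerSet 𝓓)
    (h𝓓'' : IsLowerSet 𝓓'') (h𝓤' : IsUpperSet 𝓤') (hl : l ∉ U) {J : Finset V}
    (hloop : ∀ e r, r ∈ insert h (↑J : Set V) → ends e ≠ s(r, r))
    (hF : ∀ x, F x → ∀ S ∈ 𝓤, x ∈ S)
    (hout : ∀ x ∈ U, x ≠ h → x ∉ J →
      F x ∨ x ∈ X ∨ (∃ e y, ends e = s(x, y) ∧ y ∉ U) ∨ (∀ e, x ∉ ends e))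
    (hX : ∀ x ∈ X, x ∈ U → ∀ e, x ∈ ends e → ends e = s(x, x))
    (hhX : h ∉ X) (hJX : ∀ u ∈ J, u ∉ X)
    (hcan : ∀ T ⊆ J, ∀ ζ ∈ gOutSide ends l h 𝓤 𝓓 𝓓'' X 𝓤' U ξ, escSetE ends J U ζ = T →
      let R : Set V := insert h (↑(J \ T) : Set V)
      Pure ends R l ζ ∧ UnitsDisjoint ends R l ζ ∧ Attached ends R l ζ ∧
        Clustered ends R l ζ ∧ NoStray ends R l ζ ∧ (∀ u ∈ unitsR ends R l ζ, u ⊆ U) ∧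
        (∀ u ∈ (↑T : Set V), ∃ v ∈ unitsR ends R l ζ,
          u ∈ cluster ends (decoRoute ends v (baseDeco ends R l ζ)) l))
    {𝓔 : Set (Set E)} (h𝓔 : IsUpperSet 𝓔) :
    ((gOutSide ends l h 𝓤 𝓓 𝓓'' X 𝓤' U ξ).filter fun ζ => redEdges ends ζ h ∈ 𝓔).card ≤
      ((gOutSide ends l h 𝓤 𝓓 𝓓'' X 𝓤' U ξ).filter fun ζ => blueEdges ends ζ h ∈ 𝓔).card := by
  set C := gOutSide ends l h 𝓤 𝓓 𝓓'' X 𝓤' U ξ with hC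
  have hmap : ∀ (P' : Config E → Prop) [DecidablePred P'], ∀ ζ ∈ C.filter P',
      escSetE ends J U ζ ∈ J.powerset :=
    fun _ _ _ _ => Finset.mem_powerset.2 (Finset.filter_subset _ _)
  rw [Finset.card_eq_sum_card_fiberwise (hmap (fun ζ => redEdges ends ζ h ∈ 𝓔)),
    Finset.card_eq_sum_card_fiberwise (hmap (fun ζ => blueEdges ends ζ h ∈ 𝓔))]
  refine Finset.sum_le_sum fun T hT => ?_
  have hTJ : T ⊆ J := Finset.mem_powerset.1 hT
  have hfib : ∀ (P' : Config E → Prop) [DecidablePred P'],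
      (C.filter P').filter (fun ζ => escSetE ends J U ζ = T) =
        C.filter (fun ζ => ((∀ r ∈ insert h (↑(J \ T) : Set V), hull ends ζ r ⊆ U) ∧
          (∀ u ∈ (↑T : Set V), ¬ hull ends ζ u ⊆ U)) ∧ P' ζ) := by
    intro P' _
    ext ζ
    simp only [Finset.mem_filter]
    constructor
    · rintro ⟨⟨hζ, hP⟩, hesc⟩
      exact ⟨hζ, (mem_fibreE_iff hTJ hζ).1 hesc, hP⟩
    · rintro ⟨hζ, hpart, hP⟩
      exact ⟨⟨hζ, hP⟩, (mem_fibreE_iff hTJ hζ).2 hpart⟩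
  rw [hfib (fun ζ => redEdges ends ζ h ∈ 𝓔), hfib (fun ζ => blueEdges ends ζ h ∈ 𝓔)]
  -- the fibre theorem with the roots `h` and `J ∖ T`, the junctions of `T` escaping
  have hsub : insert h (↑(J \ T) : Set V) ⊆ insert h (↑J : Set V) := by
    rintro r (rfl | hr)
    · exact Or.inl rfl
    · rw [Finset.mem_coe, Finset.mem_sdiff] at hr
      exact Or.inr (Finset.mem_coe.2 hr.1)
  have main := rigidOK_g_of_decoFibre (ends := ends) (U := U) (ξ := ξ) (l := l) (h := h)
    (X := X) (R := insert h (↑(J \ T) : Set V)) (F := F) h𝓤 h𝓓 h𝓓'' h𝓤' hl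
    (Or.inl rfl) (fun e r hr => hloop e r (hsub hr)) hF (↑T : Set V) ?_ hX ?_ ?_ h𝓔
  · rw [hC]; convert main using 3; rfl
  · intro x hxU hxR
    have hxh : x ≠ h := fun h' => hxR (h' ▸ Or.inl rfl)
    by_cases hxJ : x ∈ J
    · have hxT : x ∈ T := by
        by_contra hxT
        exact hxR (Or.inr (by rw [Finset.mem_coe, Finset.mem_sdiff]; exact ⟨hxJ, hxT⟩))
      exact Or.inr (Or.inr (Or.inr (Or.inr (Finset.mem_coe.2 hxT))))
    · rcases hout x hxU hxh hxJ with hf | hxX | hout' | hiso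
      · exact Or.inl hf
      · exact Or.inr (Or.inl hxX)
      · exact Or.inr (Or.inr (Or.inl hout'))
      · exact Or.inr (Or.inr (Or.inr (Or.inl hiso)))
  · rintro r (rfl | hr)
    · exact hhX
    · rw [Finset.mem_coe, Finset.mem_sdiff] at hr
      exact hJX r hr.1
  · intro ζ hζ hne hT'
    exact hcan T hTJ ζ hζ ((mem_fibreE_iff hTJ hζ).2 ⟨hne, hT'⟩)

end LocRows

end Summit.Ventures.PercRepro2
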